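import Summits.BirchSwinnertonDyer.Rank1Residual.Supersingular.TwistStability
import Summits.BirchSwinnertonDyer.Rank1Residual.Supersingular.KobayashiMainConjectureX7
import Summits.BirchSwinnertonDyer.Rank1Residual.Additive.QuadraticTwistSurj
import Literature.NumberTheory.EllipticCurves.YanZhu2026.TwistGoodOrdinaryProofs
import Literature.NumberTheory.EllipticCurves.BurungaleSkinnerTianWan2024.SupersingularTwistPPartOPEN
import HarnessLib

/-!
# The AUXILIARY CURVES of the signed descent for K2R″ `SignedLowerDescentFromCommonFrame` (route SignedBaseChange,
# crux stmt-BirchSwinnertonDyer-20503): globally minimal models of `E^K`, `E^{(d)}`, `E^{(dK)}` are good supersingular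
# at `p` with surjective `ρ̄` (ROUTE-INDEPENDENT file; registered stub `stub_auxiliaryCurves`; seat `bsd-wall-sbc-p2`)

The two-variable signed descent of the twist pair `(E, E^{(d)})` over `K` lands, after cyclotomic specialisation, on
the FOUR `ℚ`-curves `E, E^K, E^{(d)}, E^{(dK)}` (BSTW arXiv:2409.01350 §10.3); Kobayashi's Thm. 1.2 / 4.1 for each of
them needs: a globally minimal model, good reduction at `p`, `a_p = 0`, `ρ̄_{·,p}` onto. This file SUPPLIES those
curves from the data of K1′'s package (`p ≥ 5`, `(E, p)` an X7 pair with `Surj`, `K` imaginary quadratic with `p`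
split, `d` square-free with every prime ramified in `ℚ(√d)` different from `p`, `C • W' = W^{(d)}`):
* `goodSS_surj_of_smul_eq_quadraticTwist` — square-free twisting parameter prime to the odd prime `p`
  (`TwistStability` + `surj_iff_of_model_twist`);
* `goodSS_surj_of_smul_eq_quadraticTwist_discr` — twisting by `disc K` for a quadratic field with `p ∤ disc K`
  (`disc K` square-free or `4m`, as in `isOrdinaryAt_of_smul_eq_quadraticTwist_discr`);
* `stub_auxiliaryCurves` — the registered stub (P0) of the K2R″ skeleton: minimal models `W₂` of `E^K` and `W₄` of
  `E^{(dK)}` EXIST (`exists_isGloballyMinimal_smul_eq_quadraticTwist`) and `W₂, W', W₄` are good supersingular at `p`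
  with `a_p = 0` and `ρ̄` onto.
No Theses import (importable by skeletons and route files alike). References: [SilvermanAEC2009] VII.5 Prop. 5.1,
X.5 Cor. 5.4; [Knapp1993] Prop. 12.10; [NeukirchANT1999] III (2.12).
-/

set_option autoImplicit false

noncomputable section

open scoped Classical

open WeierstrassCurve Literature.NumberTheory.EllipticCurves Literature.NumberTheory.EllipticCurves.Rank1Residual
  Literature.NumberTheory.EllipticCurves.BurungaleSkinnerTianWan2024
  Summit.BirchSwinnertonDyer.Rank1Residual.Supersingular Summit.BirchSwinnertonDyer.Rank1Residual.Additive

namespace Summit.BirchSwinnertonDyer.BirchSwinnertonDyer.Theorems.SignedBaseChangeAuxiliaryCurves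

/-- **A twist by a square-free `d` prime to the odd prime `p` stays good supersingular with surjective `ρ̄`**:
`C • V' = V^{(d)}`, `V` good at `p` with `a_p(V) = 0` and `ρ̄_{V,p}` onto ⇒ the same for `V'`
(`a_p(V') = (d/p)·a_p(V)`; `ρ̄` of a twist is onto iff `ρ̄` is). [cite: Knapp1993, Prop. 12.10]
[cite: SilvermanAEC2009, VII.5 Prop. 5.1(a) and X.5 Cor. 5.4] -/
theorem goodSS_surj_of_smul_eq_quadraticTwist (V V' : WeierstrassCurve ℚ) [V.IsElliptic] [V.IsGloballyMinimal]
    [V'.IsElliptic] [V'.IsGloballyMinimal] (p : ℕ) [Fact p.Prime] (hp2 : p ≠ 2) {d : ℤ} (hd : Squarefree d)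
    (hpd : ¬ (p : ℤ) ∣ d) {C : VariableChange ℚ} (hC : C • V' = V.quadraticTwist (d : ℚ))
    (hgood : V.HasGoodReductionAtPrime p) (hap : V.frobeniusTrace p = 0) (hs : Surj V p) :
    V'.HasGoodReductionAtPrime p ∧ V'.frobeniusTrace p = 0 ∧ Surj V' p := by
  have hpP : p.Prime := Fact.out
  have hp2d : ¬ (p : ℤ) ∣ 2 * d := by
    intro h
    rcases (Nat.prime_iff_prime_int.mp hpP).dvd_or_dvd h with h2 | hd'
    · have : p ∣ 2 := by exact_mod_cast h2
      exact hp2 ((Nat.prime_dvd_prime_iff_eq hpP Nat.prime_two).mp this)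
    · exact hpd hd'
  have hd0 : (d : ℚ) ≠ 0 := by exact_mod_cast hd.ne_zero
  refine ⟨hasGoodReductionAtPrime_of_smul_eq_quadraticTwist V V' p hC hp2d hgood, ?_, ?_⟩
  · rw [frobeniusTrace_of_smul_eq_quadraticTwist V V' p hd hC hp2d hgood, hap, mul_zero]
  · exact (surj_iff_of_model_twist V p hd0 ⟨C⁻¹, by rw [← hC, inv_smul_smul]⟩).mpr hs

/-- **A twist by the discriminant of a quadratic field `K` with `p ∤ disc K` (odd `p`) stays good supersingular
with surjective `ρ̄`**: `disc K` is square-free or `4m` with `m` square-free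
(`Quadratic.isFundamentalDiscriminant_discr`), and `V^{(4m)} ≅ V^{(m)}` over `ℚ`
(`exists_variableChange_quadraticTwist_mul_sq`). [cite: Knapp1993, Prop. 12.10] [cite: NeukirchANT1999, Ch. III Cor. (2.12)] -/
theorem goodSS_surj_of_smul_eq_quadraticTwist_discr {K : Type*} [Field K] [NumberField K]
    (h2 : Module.finrank ℚ K = 2) (V V' : WeierstrassCurve ℚ) [V.IsElliptic] [V.IsGloballyMinimal]
    [V'.IsElliptic] [V'.IsGloballyMinimal] (p : ℕ) [Fact p.Prime] (hp2 : p ≠ 2)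
    (hpD : ¬ (p : ℤ) ∣ NumberField.discr K) {C : VariableChange ℚ}
    (hC : C • V' = V.quadraticTwist (NumberField.discr K : ℚ))
    (hgood : V.HasGoodReductionAtPrime p) (hap : V.frobeniusTrace p = 0) (hs : Surj V p) :
    V'.HasGoodReductionAtPrime p ∧ V'.frobeniusTrace p = 0 ∧ Surj V' p := by
  rcases Literature.NumberTheory.QuadraticFields.Quadratic.isFundamentalDiscriminant_discr h2 with
    ⟨-, hsq, -⟩ | ⟨h4, -, hsq⟩
  · exact goodSS_surj_of_smul_eq_quadraticTwist V V' p hp2 hsq hpD hC hgood hap hs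
  · set m : ℤ := NumberField.discr K / 4 with hm
    have hdm : NumberField.discr K = m * 2 ^ 2 := by
      rw [hm]; have := Int.ediv_mul_cancel h4; omega
    obtain ⟨C₂, hC₂⟩ := V.exists_variableChange_quadraticTwist_mul_sq (m : ℚ) 2 two_ne_zero
    have hcast : ((NumberField.discr K : ℤ) : ℚ) = (m : ℚ) * 2 ^ 2 := by rw [hdm]; push_cast; ring
    have hC' : (C₂⁻¹ * C) • V' = V.quadraticTwist (m : ℚ) := by
      rw [mul_smul, hC, hcast, ← hC₂, inv_smul_smul]
    have hpm : ¬ (p : ℤ) ∣ m := fun h ↦ hpD (hdm ▸ dvd_mul_of_dvd_left h _)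
    exact goodSS_surj_of_smul_eq_quadraticTwist V V' p hp2 hsq hpm hC' hgood hap hs

/-- **Registered stub (P0) of the K2R″ skeleton — the auxiliary curves.** For an X7 pair `(W, p)` with `p ≥ 5` and
`ρ̄` onto, `K` imaginary quadratic with `p` split, and an admissible twist `W'` of `W` by a square-free `d` (every
prime ramified in `ℚ(√d)` is `≠ p`), there are globally minimal models `W₂` of `E^K = E^{(disc K)}` and `W₄` of
`E^{(dK)} = (E^{(d)})^{(disc K)}`, and each of `W₂, W', W₄` has good reduction at `p` with `a_p = 0` and surjective
`ρ̄_{·,p}` — the side conditions under which Kobayashi Thm. 1.2 / 4.1 apply to the four `ℚ`-curves of the descent.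
[cite: SilvermanAEC2009, VII.5 Prop. 5.1(a), VIII.8 and X.5 Cor. 5.4] [cite: Knapp1993, Prop. 12.10] -/
theorem stub_auxiliaryCurves : ∀ (W : WeierstrassCurve ℚ) [W.IsElliptic] [W.IsGloballyMinimal] (p : ℕ)
    [Fact p.Prime], 5 ≤ p → Literature.NumberTheory.EllipticCurves.Rank1Residual.ClassX7 W p →
    Literature.NumberTheory.EllipticCurves.Rank1Residual.Surj W p →
    ∀ (K : Type) [Field K] [NumberField K] (N : ℕ) (d : ℤ) (W' : WeierstrassCurve ℚ) [W'.IsElliptic]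
      [W'.IsGloballyMinimal] (C : WeierstrassCurve.VariableChange ℚ),
    Squarefree d →
    (∀ q : ℕ, q.Prime → Literature.NumberTheory.EllipticCurves.BurungaleSkinnerTianWan2024.RamifiedInQuadratic d q →
      q ≠ p ∧ ¬ q ∣ N ∧ ¬ (q : ℤ) ∣ NumberField.discr K) →
    C • W' = W.quadraticTwist (d : ℚ) →
    Literature.NumberTheory.EllipticCurves.IsImaginaryQuadratic K →
    ((Ideal.span {(p : ℤ)}).primesOver (NumberField.RingOfIntegers K)).ncard = 2 →
    ∃ (W₂ W₄ : WeierstrassCurve ℚ) (_ : W₂.IsElliptic) (_ : W₂.IsGloballyMinimal) (_ : W₄.IsElliptic)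
      (_ : W₄.IsGloballyMinimal) (C₂ C₄ : WeierstrassCurve.VariableChange ℚ),
      C₂ • W₂ = W.quadraticTwist (NumberField.discr K : ℚ) ∧ C₄ • W₄ = W'.quadraticTwist (NumberField.discr K : ℚ) ∧
      (W₂.HasGoodReductionAtPrime p ∧ W₂.frobeniusTrace p = 0 ∧
        Literature.NumberTheory.EllipticCurves.Rank1Residual.Surj W₂ p) ∧
      (W'.HasGoodReductionAtPrime p ∧ W'.frobeniusTrace p = 0 ∧
        Literature.NumberTheory.EllipticCurves.Rank1Residual.Surj W' p) ∧
      (W₄.HasGoodReductionAtPrime p ∧ W₄.frobeniusTrace p = 0 ∧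
        Literature.NumberTheory.EllipticCurves.Rank1Residual.Surj W₄ p) := by
  intro W _ _ p _ hp5 hX hs K _ _ N d W' _ _ C hd hram hC hK hsplit
  have hpP : p.Prime := Fact.out
  have hp2 : p ≠ 2 := by omega
  have hgood : W.HasGoodReductionAtPrime p := hX.1.1
  have hap : W.frobeniusTrace p = 0 := ClassX7.frobeniusTrace_eq_zero_of_five_le W p hp5 hX
  -- `p ∤ d` (a prime dividing `d` ramifies in `ℚ(√d)`) and `p ∤ disc K` (`p` splits in `K`)
  have hpd : ¬ (p : ℤ) ∣ d := fun h ↦ (hram p hpP (Or.inl h)).1 rfl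
  have hpD : ¬ (p : ℤ) ∣ NumberField.discr K := not_dvd_discr_of_ncard_primesOver_eq_two hK.1 hpP hsplit
  have hD0 : (NumberField.discr K : ℚ) ≠ 0 := by exact_mod_cast NumberField.discr_ne_zero K
  -- `W' ≃ E^{(d)}`
  obtain ⟨hgood', hap', hs'⟩ := goodSS_surj_of_smul_eq_quadraticTwist W W' p hp2 hd hpd hC hgood hap hs
  -- `W₂ ≃ E^{(disc K)}`, `W₄ ≃ (E^{(d)})^{(disc K)}`
  obtain ⟨W₂, _, _, C₂, hC₂⟩ := exists_isGloballyMinimal_smul_eq_quadraticTwist W hD0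
  obtain ⟨W₄, _, _, C₄, hC₄⟩ := exists_isGloballyMinimal_smul_eq_quadraticTwist W' hD0
  exact ⟨W₂, W₄, inferInstance, inferInstance, inferInstance, inferInstance, C₂, C₄, hC₂, hC₄,
    goodSS_surj_of_smul_eq_quadraticTwist_discr hK.1 W W₂ p hp2 hpD hC₂ hgood hap hs,
    ⟨hgood', hap', hs'⟩,
    goodSS_surj_of_smul_eq_quadraticTwist_discr hK.1 W' W₄ p hp2 hpD hC₄ hgood' hap' hs'⟩

end Summit.BirchSwinnertonDyer.BirchSwinnertonDyer.Theorems.SignedBaseChangeAuxiliaryCurves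

end
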